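import Literature.MathematicalPhysics.QuantumFieldTheory.Balaban1983to89.B10Eq69TorusPullback
import Literature.MathematicalPhysics.QuantumFieldTheory.Balaban1983to89.B10NestedMinimizer

/-!
# `Balaban1983to89.B10Eq42TorusConstraint` — [Balaban1985UV3] p. 266 **(42)** «U: Ū^j = V_j on Λ_j, j = 0, 1, …, k» and p. 273
# **(67)** «Ū_k^j = V_j on Λ_j» WITH BODIES ON THE TORUS CARRIER OF RECORD `T_η = Setup.Site P 0`, FOR PRINT'S OWN AVERAGING
# (the `j`-fold average (42)–(43) of [4], `B10Eq69TorusPullback.avgT`), the minimisation clause of (42), its dictionary to the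
# cell's abstract `B10NestedMinimizer.LevelMin`, and Sect. D's knit with the hypothesis (67) DISCHARGED from the constraint (42)

T. Bałaban, *Ultraviolet stability of three-dimensional lattice pure gauge field theories*, Commun. Math. Phys. **102**, 255–275
(1985) [Balaban1985UV3] (cell paper B10; held `paper:balaban1985-cmp102-uv-stability-3d`, journal page = PDF page + 254; p. 266 =
[PDF 12] re-read 2026-08-25 for this file on the text layer `p0012.txt` L23–26, p. 273 = [PDF 19] on `p0019.txt` L11–16).  «[7]» =
T. Bałaban, *The variational problem and background fields in renormalization group method for lattice gauge theories*, Commun.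
Math. Phys. **102**, 277–309 (1985) [Balaban1985Variational] (cell paper B11; p. 278 = [PDF 2] read AS IMAGE on the render
`b2b-balaban-ref1/pages/1985-cmp102-variational-background/…-p002-x2.png`, p. 279 = [PDF 3] on `p0003.txt`).  «[4]» = T. Bałaban,
*Averaging operations for lattice gauge theories*, Commun. Math. Phys. **98**, 17–51 (1985) [Balaban1985Averaging].  «…» = verbatim.

HONEST FRAMING (mega-formalization `lit-balaban`, verbatim): statement-level skeleton of published theorems with citation tags; proofs
where landed; nothing here is a claim about the Yang–Mills mass gap.

## The printed text

[Balaban1985UV3] p. 266: «The configuration U_k is determined by the variational problem considered in [7], i.e. it is a minimum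
of the functional  U → A^η(U),  U: Ū^j = V_j on Λ_j, j = 0, 1, …, k,  (42)  where we have put Λ₀ = Ω₁ᶜ and V_k = V.»  (with,
before (40): «We define the sets Λ_j, 𝔅_k as in [5], i.e. Λ_j = Ω_j^{(j)}∖Ω_{j+1}^{(j)}», and (40) «where we have denoted V_k = V»
on `Ω_k^{(k)}`.)  p. 273: «Let us take a plaquette p′ ⊂ Λ_j and such that |V_j(∂p′) − 1| ≥ g_jp(g_j). We have  Ū_k^j = V_j on Λ_j,
(67)  and the configuration U_k satisfies the following regularity condition on B^j(Λ_j) …(68)».  [7] p. 278: «the space 𝔅_k(𝔅_k, V)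
by the conditions  Ū^j = V on Λ_j, j = 0, 1, …, k,  (3)  where V is a fixed gauge field configuration define on 𝔅_k. … If p′ ⊂ Λ_j,
i.e. all four vertices of p′ belong to Λ_j, then … all four bonds of the boundary ∂p′ belong to Λ_j and we have (∂V)(p′) = V(∂p′).»;
«We consider the functional  A(U) = A^η(U) = Σ_{p⊂Ω₀} η^{d−4}[1 − Re tr U(∂p)], η = L^{−k}  (5)  on the space of gauge field
configurations  U_k({Ω_j}, ε₀) ∩ 𝔅_k(𝔅_k, V)  (6)»; p. 279 Theorem 1: «there exists a minimal orbit in the space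
U_k({Ω_j}, B₃ε₁) ∩ 𝔅_k(𝔅_k, V). (8) … Minimal configurations will be denoted by U_k(V), or U_k.»

## Why this file exists (unit `lit-balaban-r07`, reader/typer and fold owner of B10; gen 58; rows B10.Eq42 / B10.Eq67 members,
## B10.Eq69 / Eq71 knit riders)

Until now the constraint of (42) — [7]'s space (3) — existed in the tree on the model lattice `ℤ^d` (`B11Eq7Convention.InB`, r2, with
`Ū^j = B7Prop2Explicit.avgIter`) and ABSTRACTLY as the datum clause `C (U_k y) = y` of the cell's `B10NestedMinimizer.LevelMin`
(b2b; «nothing is computed from a lattice», cell DIVERGENCE D-b10.8); and (67) entered Sect. D's torus knit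
`B10Eq69TorusPullback.quarter_sum_le_wilsonAction_concrete` (gen 57) as the per-plaquette HYPOTHESIS `h67`.  Since gen 57 the tree has
print's own averaging ON THE TORUS (`avgT`), so (42)/(67) can be given bodies on the carrier of record:

* §1 `bondsIn j X` / `mem_bondsIn_of_mem_plaqsIn` — the bonds of `T^{(j)}` lying in a region `X ⊂ T_η` ([7] p. 278: «all four bonds of
  the boundary ∂p′ belong to Λ_j» when «all four vertices of p′ belong to Λ_j», the cell's `B10Eq38TorusDomains.plaqsIn`);
* §2 **`Constraint42 k Λ V U`** — «U: Ū^j = V_j on Λ_j, j = 0, 1, …, k» (= [7] (3)) WITH BODY: for every `j ≤ k` and every bond `b` of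
  `T^{(j)}` inside `Λ_j`, `Ū^j_b = (V_j)_b` as matrices, `Ū^j = avgT j U`; **`lam42 Ω k`** — print's regions «Λ_j = Ω_j^{(j)}∖Ω_{j+1}^{(j)}»
  (`j < k`), `Λ_k = Ω_k^{(k)}` («V_k = V»), with «Λ₀ = Ω₁ᶜ» the theorem `lam42_zero` for `Ω₀ = T_η`; non-vacuity `constraint42_one`
  (`U ≡ 1` satisfies (42) for the data `V_j ≡ 1`: `Ū^j(1) = 1`, `B7Eq92Concrete.avgIter_one` BY NAME);
* §3 **(67) FROM (42)**: `eq67_of_constraint42` — for `p′ ⊂ Λ_j` (`p′ ∈ plaqsIn j (Λ j)`), `Ū_k^j(∂p′) = V_j(∂p′)` (gen 57's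
  `h67_of_bonds` fed by §1);
* §4 **`IsMin42 A R k Λ V U`** — «it is a minimum of the functional U → A^η(U), U: Ū^j = V_j on Λ_j» read, as [7] (6)/(8) do, inside a
  region `R` of configurations (print: [7]'s `U_k({Ω_j}, B₃ε₁)` of (8); `R = Set.univ` is the literal sentence of (42); the local
  reading of cell DIVERGENCE D-B11-2 is another `R`): `U ∈ R`, `U` satisfies (42), and `A U ≤ A U′` for every `U′ ∈ R` satisfying (42)
  — `isMin42_iff_isMinOn` (Mathlib's `IsMinOn` on `R ∩ {(42)}`), `actionEta k` = «A^η» = `Setup.wilsonAction (L^k)` = (5) of [7] at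
  `d = 3` (weight `η^{d−4} = η^{−1} = L^k`), `actionEta_nonneg`, `actionEta_one`, non-vacuity **`isMin42_one`** (`U ≡ 1` is a (42)-minimum
  for `V ≡ 1` in any region containing it);
* §5 **DICTIONARY TO `B10NestedMinimizer`** (the gen-57 HANDOFF target «(67) identification from `LevelMin` for print's averaging»): the
  CONCRETE datum map `datum k Λ : (configurations on T_η) → KData` (`U ↦ (Ū^j↾Λ_j)_{j≤k}`, zero off the constraint bonds) and the
  embedding `ofData k Λ V` of data, with `datum_eq_ofData_iff` (`C U = y ↔ (42)`), `fibK_datum` (`B10NestedMinimizer.fibK (datum k Λ)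
  (ofData k Λ V) = {U | Constraint42 k Λ V U}` — [7]'s `𝔅_k(𝔅_k, V)` on the torus), **`isMin42_of_levelMin`** / **`levelMin_of_isMin42`**
  (`LevelMin A (datum k Λ) R T U_k` IS «U_k(y) is a (42)-minimum in `R y` for every admissible datum `y ∈ T`»), and
  **`eq67_of_levelMin`** — (67) for `U_k = U_k(y)` from the package;
* §6 **THE KNIT**: for the domains generated by the p. 268 rule from the large-field plaquette sets (`B10Eq71TorusOverlap.Ω`), a
  large-field plaquette of the passage `j → j+1` made on the domain LIES IN `Λ_j` (= the cell's `B10LargeField.Λ` of the generated `ruleSeq`, `lam42_eq_Λ_ruleSeq`) — `mem_plaqsIn_lam42` («Let us take a plaquette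
  p′ ⊂ Λ_j», from `B10Eq38TorusDomains.largeField_subset_Z_ruleSeq`) — and **`quarter_sum_le_wilsonAction_of_constraint42`** (`U(N)`) /
  `…_specialUnitaryGroup` (`SU(N)`): gen 57's `quarter_sum_le_wilsonAction_concrete` with `h67` DISCHARGED from `Constraint42 k (lam42 Ω k) V U_k`
  — «We get these small factors for all plaquettes in all large fields set P» against `(N/g_k²)A^η(U_k)` from (42), the large-field
  condition and (68) alone; `quarter_sum_le_wilsonAction_of_levelMin` — the same for `U_k = U_k(y)` of a `LevelMin` package.

DICTIONARY print ↦ Lean: `Ū^j` ↦ `avgT j U` (gen 57; values in `M_N(ℂ)ˣ`); «on Λ_j» (bonds) ↦ `b ∈ bondsIn j (Λ j)`, «p′ ⊂ Λ_j» ↦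
`p′ ∈ plaqsIn j (Λ j)` (all four corners, read in `T_η` by `B10Eq38TorusDomains.toFine`); `V_j` ↦ `V j : GaugeField P j U(N)` (a family
indexed by all `j`, used for `j ≤ k`; «V_k = V»); `A^η` ↦ `actionEta k = wilsonAction (L^k)` (normalised trace `reTr`, cell DIVERGENCE
D-b10.1); [7]'s region (8) ↦ the parameter `R`; `U_k` ↦ a configuration satisfying `IsMin42 …` / the value `Uk y` of a `LevelMin` package.

HONEST SCOPE.  (i) EXISTENCE of a (42)-minimum and its uniqueness modulo gauge transformations are [7] Theorem 1 (row B11.Thm1, a typed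
statement row of the cell; `B11Thm1.Thm1At`, `B10NestedMinimizer.levelMin_of_thm1At` give the abstract edge) and are NOT asserted here:
`U_k` is a PARAMETER satisfying `IsMin42` (equivalently the value of a `LevelMin` package, §5); `isMin42_one` only witnesses
non-vacuity at `V ≡ 1`.  (ii) The region `R` ([7] (2)/(8): `U_k({Ω_j}, B₃ε₁)`) is a parameter: the regularity (68) = membership in (8)
stays the hypothesis `h68` of §6 exactly as in gen 57 (p. 267 (44) / [7] Thm 1).  (iii) `Ū^j` is [4]'s (42)–(43) (`avgT`), not an
inhabitant of the cell's `Setup.Averaging`; `G = U(N)` (`SU(N)` through `B10Eq27TorusAxialLog.toUField` in §6).  (iv) [7] (3) on `ℤ^d`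
(`B11Eq7Convention.InB`, its boundary convention (7)) is r2's and is neither imported nor restated; this file types B10's display (42)
with B10's conventions on B10's carrier.  (v) Nothing of [Balaban1985UV3], [7] or [4] beyond the quoted sentences is asserted;
`B10Eq69TorusPullback` (gen 57), `B10Eq38TorusDomains` (gen 52), `B10Eq71TorusOverlap` (gen 55), `B10NestedMinimizer` (b2b),
`B7Eq92Concrete.avgIter_one` are used BY NAME.

WHAT THIS FILE PROVES (kernel, no `sorry`, no named facts, no structures; definitions with bodies `bondsIn`, `Constraint42`, `lam42`,
`actionEta`, `IsMin42`, `KData`, `datum`, `ofData`; theorems otherwise; axioms standard).  Value = rows B10.Eq42 / B10.Eq67 gain bodies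
on the carrier of record for print's averaging, the abstract `LevelMin` acquires its concrete torus dictionary, and Sect. D's torus
chain (67)–(71) now starts from (42); NOT summit progress.
-/

noncomputable section

open scoped BigOperators

namespace Literature.MathematicalPhysics.QuantumFieldTheory.Balaban1983to89.B10Eq42TorusConstraint

open B7Prop1Explicit (plaqWord)
open B7Prop2Explicit (avgIter C0 c2')
open B10Eq27TorusAxialLog (holT pull pull_apply unitsField val_unitsField toUField)
open B10Eq38TorusDomains (toFine cornerSet plaqsIn mem_plaqsIn_iff cornerPts cornerSet_subset_cornerPts omegaSeq
  largeField_subset_Z_ruleSeq)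
open B10Eq69TorusPullback (avgT avgT_apply h67_of_bonds deltaAllT quarter_sum_le_wilsonAction_concrete
  quarter_sum_le_wilsonAction_concrete_specialUnitaryGroup)
open B10NestedMinimizer (fibK mem_fibK LevelMin)
open B5Ineq137Torus (fine)

variable {P : Params}

/-! ## §1 The bonds and plaquettes of `T^{(j)}` inside a region of `T_η` -/

section Bonds

variable {j : ℕ}

/-- **The bonds of `T^{(j)}` lying in a region `X ⊂ T_η`**: both endpoints `b₋`, `b₊ = b₋ + e_κ` (read in the fine torus by
`B10Eq38TorusDomains.toFine`) belong to `X` — [7] p. 278 «all four bonds of the boundary ∂p′ belong to Λ_j», the bonds on which (3)/(42)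
«Ū^j = V_j on Λ_j» is imposed. [cite: Balaban1985Variational, (3) p.278; Balaban1985UV3, (42) p.266] -/
def bondsIn (j : ℕ) (X : Set (Site P 0)) : Set (PBond P j) :=
  {b | toFine j b.src ∈ X ∧ toFine j (b.src.shift b.dir) ∈ X}

/-- Membership in `bondsIn`. [cite: Balaban1985Variational, (3) p.278] -/
theorem mem_bondsIn_iff {X : Set (Site P 0)} {b : PBond P j} :
    b ∈ bondsIn j X ↔ toFine j b.src ∈ X ∧ toFine j (b.src.shift b.dir) ∈ X := Iff.rfl

/-- `bondsIn` is monotone in the region. [cite: Balaban1985Variational, (3) p.278] -/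
theorem bondsIn_mono {X Y : Set (Site P 0)} (h : X ⊆ Y) : bondsIn j X ⊆ bondsIn j Y :=
  fun _ hb => ⟨h hb.1, h hb.2⟩

/-- **«If p′ ⊂ Λ_j, i.e. all four vertices of p′ belong to Λ_j, then … all four bonds of the boundary ∂p′ belong to Λ_j»** ([7]
p. 278): for `p′ ∈ plaqsIn j X` (all four corners in `X`) the four bonds `⟨x, μ⟩`, `⟨x + e_μ, ν⟩`, `⟨x + e_ν, μ⟩`, `⟨x, ν⟩` of `∂p′`
lie in `bondsIn j X`. [cite: Balaban1985Variational, p.278; Balaban1985UV3, (67) p.273] -/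
theorem mem_bondsIn_of_mem_plaqsIn {X : Set (Site P 0)} {p : Plaq P j} (hp : p ∈ plaqsIn j X) :
    (⟨p.src, p.μ⟩ : PBond P j) ∈ bondsIn j X ∧ (⟨p.src.shift p.μ, p.ν⟩ : PBond P j) ∈ bondsIn j X ∧
      (⟨p.src.shift p.ν, p.μ⟩ : PBond P j) ∈ bondsIn j X ∧ (⟨p.src, p.ν⟩ : PBond P j) ∈ bondsIn j X := by
  have h := mem_plaqsIn_iff.mp hp
  simp only [cornerSet, Set.insert_subset_iff, Set.singleton_subset_iff] at h
  obtain ⟨h1, h2, h3, h4⟩ := h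
  refine ⟨⟨h1, h2⟩, ⟨h2, h4⟩, ⟨h3, ?_⟩, ⟨h1, h3⟩⟩
  show toFine j ((p.src.shift p.ν).shift p.μ) ∈ X
  rw [Site.shift_comm p.src p.ν p.μ]
  exact h4

end Bonds

/-! ## §2 (42) «U: Ū^j = V_j on Λ_j, j = 0, 1, …, k» with a body on the torus, print's regions `Λ_j`, non-vacuity -/

section Constraint

open scoped Matrix.Norms.L2Operator

variable {N : ℕ}

/-- **(42) / [7] (3) WITH BODY ON THE TORUS CARRIER FOR PRINT'S AVERAGING**: «U: Ū^j = V_j on Λ_j, j = 0, 1, …, k» — for every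
level `j ≤ k` and every bond `b` of `T^{(j)}` inside `Λ_j`, the `j`-fold average (42)–(43) of [4] of `U` at `b` (`avgT j U b ∈ M_N(ℂ)ˣ`)
EQUALS the prescribed bond variable `(V_j)_b ∈ U(N)`, as matrices.  `Λ : ℕ → Set (Site P 0)` are the regions (print's choice is
`lam42`), `V j` the data («V_k = V»; levels `j > k` unused). [cite: Balaban1985UV3, (42) p.266; Balaban1985Variational, (3) p.278] -/
def Constraint42 (k : ℕ) (Λ : ℕ → Set (Site P 0)) (V : (j : ℕ) → GaugeField P j (Matrix.unitaryGroup (Fin N) ℂ))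
    (U : GaugeField P 0 (Matrix.unitaryGroup (Fin N) ℂ)) : Prop :=
  ∀ j, j ≤ k → ∀ b : PBond P j, b ∈ bondsIn j (Λ j) →
    ((avgT j U b : (Matrix (Fin N) (Fin N) ℂ)ˣ) : Matrix (Fin N) (Fin N) ℂ) =
      ((V j b : Matrix.unitaryGroup (Fin N) ℂ) : Matrix (Fin N) (Fin N) ℂ)

/-- Unfolding `Constraint42` at one bond. [cite: Balaban1985UV3, (42) p.266] -/
theorem Constraint42.eq {k : ℕ} {Λ : ℕ → Set (Site P 0)} {V : (j : ℕ) → GaugeField P j (Matrix.unitaryGroup (Fin N) ℂ)}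
    {U : GaugeField P 0 (Matrix.unitaryGroup (Fin N) ℂ)} (h : Constraint42 k Λ V U) {j : ℕ} (hj : j ≤ k) {b : PBond P j}
    (hb : b ∈ bondsIn j (Λ j)) :
    ((avgT j U b : (Matrix (Fin N) (Fin N) ℂ)ˣ) : Matrix (Fin N) (Fin N) ℂ) =
      ((V j b : Matrix.unitaryGroup (Fin N) ℂ) : Matrix (Fin N) (Fin N) ℂ) :=
  h j hj b hb

/-- (42) at level `k` restricts to (42) at any lower level `k′ ≤ k` (the constraints are nested: [7] p. 279 «assuming that it is true
for k − 1»). [cite: Balaban1985UV3, (42) p.266; Balaban1985Variational, p.279] -/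
theorem Constraint42.mono {k k' : ℕ} (hk : k' ≤ k) {Λ : ℕ → Set (Site P 0)}
    {V : (j : ℕ) → GaugeField P j (Matrix.unitaryGroup (Fin N) ℂ)} {U : GaugeField P 0 (Matrix.unitaryGroup (Fin N) ℂ)}
    (h : Constraint42 k Λ V U) : Constraint42 k' Λ V U :=
  fun j hj b hb => h j (hj.trans hk) b hb

/-- (42) is monotone under shrinking the regions. [cite: Balaban1985UV3, (42) p.266] -/
theorem Constraint42.of_subset {k : ℕ} {Λ Λ' : ℕ → Set (Site P 0)} (hΛ : ∀ j, j ≤ k → Λ' j ⊆ Λ j)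
    {V : (j : ℕ) → GaugeField P j (Matrix.unitaryGroup (Fin N) ℂ)} {U : GaugeField P 0 (Matrix.unitaryGroup (Fin N) ℂ)}
    (h : Constraint42 k Λ V U) : Constraint42 k Λ' V U :=
  fun j hj b hb => h j hj b (bondsIn_mono (hΛ j hj) hb)

/-- (42) depends on the data `V_j` only through their values on the constraint bonds. [cite: Balaban1985UV3, (42) p.266] -/
theorem Constraint42.congr_data {k : ℕ} {Λ : ℕ → Set (Site P 0)}
    {V V' : (j : ℕ) → GaugeField P j (Matrix.unitaryGroup (Fin N) ℂ)}
    (hVV' : ∀ j, j ≤ k → ∀ b : PBond P j, b ∈ bondsIn j (Λ j) → V j b = V' j b)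
    {U : GaugeField P 0 (Matrix.unitaryGroup (Fin N) ℂ)} (h : Constraint42 k Λ V U) : Constraint42 k Λ V' U :=
  fun j hj b hb => by rw [← hVV' j hj b hb]; exact h j hj b hb

/-- **PRINT'S REGIONS OF (42)**: «Λ_j = Ω_j^{(j)}∖Ω_{j+1}^{(j)}» for `j < k` (p. 266 before (40)), and at the top level `Λ_k := Ω_k^{(k)}`
(«V_k = V»: (40) prescribes `Ū^k = V` on `Ω_k^{(k)}`; the cell's `B10NestedMinimizer` dictionary «old Λ_k = Ω_k^{(k)}») — read on the
fine torus `T_η` (a region is a set of points of `T_η`, `B10Eq38TorusDomains`).  (Levels above `k` are given the value `Ω_k`; unused.)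
[cite: Balaban1985UV3, (40)–(42) p.266] -/
def lam42 (Ω : ℕ → Set (Site P 0)) (k : ℕ) : ℕ → Set (Site P 0) :=
  fun j => if j < k then Ω j \ Ω (j + 1) else Ω k

/-- `lam42` below the top level. [cite: Balaban1985UV3, (42) p.266] -/
theorem lam42_of_lt {Ω : ℕ → Set (Site P 0)} {k j : ℕ} (h : j < k) : lam42 Ω k j = Ω j \ Ω (j + 1) := by
  simp [lam42, h]

/-- `lam42` at the top level: `Λ_k = Ω_k^{(k)}` («V_k = V»). [cite: Balaban1985UV3, (40) p.266, (42) p.266] -/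
theorem lam42_self (Ω : ℕ → Set (Site P 0)) (k : ℕ) : lam42 Ω k k = Ω k := by
  simp [lam42]

/-- **«where we have put Λ₀ = Ω₁ᶜ»** (p. 266): with `Ω₀ = T_η` (the whole torus) and `k ≥ 1`, `Λ₀ = Ω₀∖Ω₁ = Ω₁ᶜ`.
[cite: Balaban1985UV3, (42) p.266] -/
theorem lam42_zero {Ω : ℕ → Set (Site P 0)} (h0 : Ω 0 = Set.univ) {k : ℕ} (hk : 0 < k) : lam42 Ω k 0 = (Ω 1)ᶜ := by
  rw [lam42_of_lt hk, h0, Set.compl_eq_univ_sdiff]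

variable [NeZero N]

/-- The periodic pullback of the trivial configuration is trivial. [cite: Balaban1985Averaging, (43) p.24] -/
theorem pull_unitsField_one {j : ℕ} (y : Site P j) :
    pull (unitsField (1 : GaugeField P j (Matrix.unitaryGroup (Fin N) ℂ))) y = 1 := by
  funext z μ
  rw [pull_apply]
  apply Units.ext
  rw [val_unitsField]
  rfl

/-- **`Ū^j(1) = 1`**: the average (42)–(43) of [4] of the trivial configuration `U ≡ 1` on the torus is trivial
(`B7Eq92Concrete.avgIter_one` BY NAME on the pullback). [cite: Balaban1985Averaging, (42)–(43) pp.23–24] -/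
theorem avgT_one (j : ℕ) (b : PBond P j) : avgT j (1 : GaugeField P 0 (Matrix.unitaryGroup (Fin N) ℂ)) b = 1 := by
  rw [avgT_apply, pull_unitsField_one, B7Eq92Concrete.avgIter_one]
  rfl

/-- **NON-VACUITY OF (42)**: the trivial configuration `U ≡ 1` satisfies «Ū^j = V_j on Λ_j, j ≤ k» for the trivial data `V_j ≡ 1`,
whatever the regions. [cite: Balaban1985UV3, (42) p.266] -/
theorem constraint42_one (k : ℕ) (Λ : ℕ → Set (Site P 0)) :
    Constraint42 k Λ (fun j => (1 : GaugeField P j (Matrix.unitaryGroup (Fin N) ℂ)))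
      (1 : GaugeField P 0 (Matrix.unitaryGroup (Fin N) ℂ)) := by
  intro j _ b _
  rw [avgT_one]
  rfl

end Constraint

/-! ## §3 (67) «Ū_k^j = V_j on Λ_j» plaquette-wise from the constraint (42) -/

section Eq67

variable {N : ℕ} [NeZero N]

/-- **(67) FROM (42)**: if `U` satisfies the constraint (42) with data `(V_j)` on the regions `(Λ_j)`, then for every level `j ≤ k`
and every plaquette `p′ ⊂ Λ_j` («all four vertices of p′ belong to Λ_j», [7] p. 278) **`Ū^j(∂p′) = V_j(∂p′)`** (as matrices; `Ū^j(∂p′)`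
= the torus transport `holT (avgT j U)` around `p′`) — p. 273 «Let us take a plaquette p′ ⊂ Λ_j … We have Ū_k^j = V_j on Λ_j, (67)»;
this is the hypothesis `h67` of `B10Eq69TorusPullback.smallFactor_of_largeField_torus_concrete` (gen 57's `h67_of_bonds` on the four
bonds of §1). [cite: Balaban1985UV3, (67) p.273, (42) p.266; Balaban1985Variational, (3) p.278] -/
theorem eq67_of_constraint42 {k : ℕ} {Λ : ℕ → Set (Site P 0)}
    {V : (j : ℕ) → GaugeField P j (Matrix.unitaryGroup (Fin N) ℂ)} {U : GaugeField P 0 (Matrix.unitaryGroup (Fin N) ℂ)}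
    (h : Constraint42 k Λ V U) {j : ℕ} (hj : j ≤ k) {p' : Plaq P j} (hp' : p' ∈ plaqsIn j (Λ j)) :
    ((holT (avgT j U) p'.src (plaqWord p'.μ p'.ν) : (Matrix (Fin N) (Fin N) ℂ)ˣ) : Matrix (Fin N) (Fin N) ℂ) =
      ((GaugeField.plaqHol (V j) p' : Matrix.unitaryGroup (Fin N) ℂ) : Matrix (Fin N) (Fin N) ℂ) := by
  obtain ⟨h1, h2, h3, h4⟩ := mem_bondsIn_of_mem_plaqsIn hp'
  exact h67_of_bonds U (V j) p' (h j hj _ h1) (h j hj _ h2) (h j hj _ h3) (h j hj _ h4)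

/-- (67) for ALL large-field plaquettes of a family `S′_j ⊆ plaqsIn j (Λ_j)`, `j ∈ J`, `j ≤ k` — the shape of the hypothesis `h67` of
`B10Eq69TorusPullback.quarter_sum_le_wilsonAction_concrete`. [cite: Balaban1985UV3, (67) p.273, (42) p.266] -/
theorem h67_of_constraint42 {k : ℕ} {Λ : ℕ → Set (Site P 0)}
    {V : (j : ℕ) → GaugeField P j (Matrix.unitaryGroup (Fin N) ℂ)} {U : GaugeField P 0 (Matrix.unitaryGroup (Fin N) ℂ)}
    (h : Constraint42 k Λ V U) (J : Finset ℕ) (hJk : ∀ j ∈ J, j ≤ k) (S' : (j : ℕ) → Finset (Plaq P j))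
    (hS' : ∀ j ∈ J, S' j ⊆ plaqsIn j (Λ j)) :
    ∀ j ∈ J, ∀ p' ∈ S' j,
      ((holT (avgT j U) p'.src (plaqWord p'.μ p'.ν) : (Matrix (Fin N) (Fin N) ℂ)ˣ) : Matrix (Fin N) (Fin N) ℂ) =
        ((GaugeField.plaqHol (V j) p' : Matrix.unitaryGroup (Fin N) ℂ) : Matrix (Fin N) (Fin N) ℂ) :=
  fun j hj _ hp' => eq67_of_constraint42 h (hJk j hj) (hS' j hj hp')

end Eq67

/-! ## §4 (42) «it is a minimum of the functional U → A^η(U)» on the constraint set, inside a region -/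

section Minimum

variable {N : ℕ}

/-- **(42): «it is a minimum of the functional U → A(U), U: Ū^j = V_j on Λ_j, j = 0, 1, …, k» INSIDE A REGION `R`** ([7] (6)/(8):
the functional (5) is considered «on the space of gauge field configurations U_k({Ω_j}, ε₀) ∩ 𝔅_k(𝔅_k, V)» and Theorem 1 gives «a
minimal orbit in the space U_k({Ω_j}, B₃ε₁) ∩ 𝔅_k(𝔅_k, V) (8)»): `U` lies in `R`, satisfies (42), and `A U ≤ A U′` for every `U′ ∈ R`
satisfying (42).  `R = Set.univ` is the literal sentence of (42); print's `R` is [7]'s (8); the local reading (cell DIVERGENCE D-B11-2) is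
a neighbourhood of the orbit.  The functional `A` is a parameter (print: `actionEta k`). [cite: Balaban1985UV3, (42) p.266; Balaban1985Variational, (5)–(8) pp.278–279] -/
def IsMin42 (A : GaugeField P 0 (Matrix.unitaryGroup (Fin N) ℂ) → ℝ) (R : Set (GaugeField P 0 (Matrix.unitaryGroup (Fin N) ℂ)))
    (k : ℕ) (Λ : ℕ → Set (Site P 0)) (V : (j : ℕ) → GaugeField P j (Matrix.unitaryGroup (Fin N) ℂ))
    (U : GaugeField P 0 (Matrix.unitaryGroup (Fin N) ℂ)) : Prop :=
  U ∈ R ∧ Constraint42 k Λ V U ∧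
    ∀ U' : GaugeField P 0 (Matrix.unitaryGroup (Fin N) ℂ), U' ∈ R → Constraint42 k Λ V U' → A U ≤ A U'

/-- A (42)-minimum satisfies (42) (hence (67), §3). [cite: Balaban1985UV3, (42) p.266, (67) p.273] -/
theorem IsMin42.constraint {A : GaugeField P 0 (Matrix.unitaryGroup (Fin N) ℂ) → ℝ}
    {R : Set (GaugeField P 0 (Matrix.unitaryGroup (Fin N) ℂ))} {k : ℕ} {Λ : ℕ → Set (Site P 0)}
    {V : (j : ℕ) → GaugeField P j (Matrix.unitaryGroup (Fin N) ℂ)} {U : GaugeField P 0 (Matrix.unitaryGroup (Fin N) ℂ)}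
    (h : IsMin42 A R k Λ V U) : Constraint42 k Λ V U :=
  h.2.1

/-- **(42) in Mathlib's vocabulary**: `U` is a (42)-minimum in `R` iff `U ∈ R ∩ {U | (42)}` and `A` attains on that set its minimum at
`U` (`IsMinOn`). [cite: Balaban1985UV3, (42) p.266] -/
theorem isMin42_iff_isMinOn {A : GaugeField P 0 (Matrix.unitaryGroup (Fin N) ℂ) → ℝ}
    {R : Set (GaugeField P 0 (Matrix.unitaryGroup (Fin N) ℂ))} {k : ℕ} {Λ : ℕ → Set (Site P 0)}
    {V : (j : ℕ) → GaugeField P j (Matrix.unitaryGroup (Fin N) ℂ)} {U : GaugeField P 0 (Matrix.unitaryGroup (Fin N) ℂ)} :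
    IsMin42 A R k Λ V U ↔
      U ∈ R ∩ {U' | Constraint42 k Λ V U'} ∧ IsMinOn A (R ∩ {U' | Constraint42 k Λ V U'}) U := by
  constructor
  · rintro ⟨hR, hC, hmin⟩
    exact ⟨⟨hR, hC⟩, isMinOn_iff.mpr fun U' hU' => hmin U' hU'.1 hU'.2⟩
  · rintro ⟨⟨hR, hC⟩, hmin⟩
    exact ⟨hR, hC, fun U' hU' hC' => isMinOn_iff.mp hmin U' ⟨hU', hC'⟩⟩

variable [NeZero N]

/-- **(67) FOR A (42)-MINIMUM**: p. 273 «We have Ū_k^j = V_j on Λ_j, (67)» for `U_k` a minimum (42) — on every `p′ ⊂ Λ_j`, `j ≤ k`.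
[cite: Balaban1985UV3, (67) p.273, (42) p.266] -/
theorem IsMin42.eq67 {A : GaugeField P 0 (Matrix.unitaryGroup (Fin N) ℂ) → ℝ}
    {R : Set (GaugeField P 0 (Matrix.unitaryGroup (Fin N) ℂ))} {k : ℕ} {Λ : ℕ → Set (Site P 0)}
    {V : (j : ℕ) → GaugeField P j (Matrix.unitaryGroup (Fin N) ℂ)} {U : GaugeField P 0 (Matrix.unitaryGroup (Fin N) ℂ)}
    (h : IsMin42 A R k Λ V U) {j : ℕ} (hj : j ≤ k) {p' : Plaq P j} (hp' : p' ∈ plaqsIn j (Λ j)) :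
    ((holT (avgT j U) p'.src (plaqWord p'.μ p'.ν) : (Matrix (Fin N) (Fin N) ℂ)ˣ) : Matrix (Fin N) (Fin N) ℂ) =
      ((GaugeField.plaqHol (V j) p' : Matrix.unitaryGroup (Fin N) ℂ) : Matrix (Fin N) (Fin N) ℂ) :=
  eq67_of_constraint42 h.constraint hj hp'

/-- **«A^η»** of (42) for the `d = 3` theory of [Balaban1985UV3]: `A^η(U) = Σ_{p⊂T_η} η^{−1}[1 − Re tr U(∂p)]` (p. 256 (1)/(5); [7] (5)
with `η^{d−4} = η^{−1}`), `η = L^{−k}` — the cell's `Setup.wilsonAction` with weight `L^k` (normalised trace `reTr`, cell DIVERGENCE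
D-b10.1), as consumed by `B10Eq69TorusPullback.quarter_sum_le_wilsonAction_concrete`. [cite: Balaban1985UV3, (1) p.256, (42) p.266; Balaban1985Variational, (5) p.278] -/
def actionEta (k : ℕ) (U : GaugeField P 0 (Matrix.unitaryGroup (Fin N) ℂ)) : ℝ :=
  wilsonAction ((P.L : ℝ) ^ k) U

/-- Unfolding `actionEta`. [cite: Balaban1985Variational, (5) p.278] -/
theorem actionEta_eq (k : ℕ) (U : GaugeField P 0 (Matrix.unitaryGroup (Fin N) ℂ)) :
    actionEta k U = wilsonAction ((P.L : ℝ) ^ k) U := rfl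

/-- `A^η ≥ 0` (each term `η^{−1}[1 − Re tr U(∂p)] ≥ 0`). [cite: Balaban1985Variational, (5) p.278] -/
theorem actionEta_nonneg (k : ℕ) (U : GaugeField P 0 (Matrix.unitaryGroup (Fin N) ℂ)) : 0 ≤ actionEta k U := by
  unfold actionEta wilsonAction
  exact Finset.sum_nonneg fun p _ =>
    mul_nonneg (by positivity) (sub_nonneg.mpr (GaugeGroup.reTr_le_one _))

/-- `A^η(1) = 0`. [cite: Balaban1985Variational, (5) p.278] -/
theorem actionEta_one (k : ℕ) : actionEta k (1 : GaugeField P 0 (Matrix.unitaryGroup (Fin N) ℂ)) = 0 := by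
  unfold actionEta wilsonAction
  refine Finset.sum_eq_zero fun p _ => ?_
  have h1 : GaugeField.plaqHol (1 : GaugeField P 0 (Matrix.unitaryGroup (Fin N) ℂ)) p = 1 := by
    simp [GaugeField.plaqHol, show ∀ b : PBond P 0, (1 : GaugeField P 0 (Matrix.unitaryGroup (Fin N) ℂ)) b = 1 from fun _ => rfl]
  rw [h1, GaugeGroup.reTr_one, sub_self, mul_zero]

/-- **NON-VACUITY OF (42) AS A MINIMISATION**: for the trivial data `V_j ≡ 1` the trivial configuration `U ≡ 1` IS a minimum (42) of
`A^η` in any region containing it (`A^η(1) = 0 ≤ A^η(U′)`). [cite: Balaban1985UV3, (42) p.266; Balaban1985Variational, (5) p.278] -/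
theorem isMin42_one (R : Set (GaugeField P 0 (Matrix.unitaryGroup (Fin N) ℂ))) (hR : (1 : GaugeField P 0 _) ∈ R) (k : ℕ)
    (Λ : ℕ → Set (Site P 0)) :
    IsMin42 (actionEta k) R k Λ (fun j => (1 : GaugeField P j (Matrix.unitaryGroup (Fin N) ℂ))) 1 :=
  ⟨hR, constraint42_one k Λ, fun U' _ _ => by rw [actionEta_one]; exact actionEta_nonneg k U'⟩

end Minimum

/-! ## §5 Dictionary to the cell's abstract `B10NestedMinimizer.LevelMin` (the concrete datum map of (42) on the torus) -/

section LevelMinDict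

variable {N : ℕ}

variable (P N) in
/-- **k-DATA ON THE TORUS**: a family assigning a matrix to every bond of every level — the carrier `Y` («k-data y = (V₀↾Λ₀, …,
V_{k−1}↾Λ_{k−1}; V_k↾Ω_k^{(k)})») of the cell's `B10NestedMinimizer` dictionary, read concretely; only the values on the constraint
bonds `bondsIn j (Λ_j)`, `j ≤ k`, matter (`datum`, `ofData` vanish elsewhere). [cite: Balaban1985UV3, (42) p.266] -/
def KData : Type := (j : ℕ) → PBond P j → Matrix (Fin N) (Fin N) ℂ

open scoped Classical in
/-- **THE CONCRETE DATUM MAP `C` OF (42)**: `U ↦ ((Ū^j↾Λ_j)_{j ≤ k})` — the average `avgT j U` on the constraint bonds of the levels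
`j ≤ k` (as matrices), `0` elsewhere (the cell's abstract `C : X → Y`, «U ↦ ((Ū^j↾Λ_j)_{j<k}, Ū^k↾Ω_k^{(k)})», here with print's own
averaging on the torus). [cite: Balaban1985UV3, (42) p.266; Balaban1985Averaging, (43) p.24] -/
def datum (k : ℕ) (Λ : ℕ → Set (Site P 0)) (U : GaugeField P 0 (Matrix.unitaryGroup (Fin N) ℂ)) : KData P N :=
  fun j b => if j ≤ k ∧ b ∈ bondsIn j (Λ j) then ((avgT j U b : (Matrix (Fin N) (Fin N) ℂ)ˣ) : Matrix (Fin N) (Fin N) ℂ) else 0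

open scoped Classical in
/-- The k-datum DETERMINED BY THE DATA `(V_j)`: their values on the constraint bonds of the levels `j ≤ k`, `0` elsewhere («V is a
fixed gauge field configuration define on 𝔅_k», [7] p. 278). [cite: Balaban1985Variational, (3) p.278; Balaban1985UV3, (42) p.266] -/
def ofData (k : ℕ) (Λ : ℕ → Set (Site P 0)) (V : (j : ℕ) → GaugeField P j (Matrix.unitaryGroup (Fin N) ℂ)) : KData P N :=
  fun j b => if j ≤ k ∧ b ∈ bondsIn j (Λ j) then ((V j b : Matrix.unitaryGroup (Fin N) ℂ) : Matrix (Fin N) (Fin N) ℂ) else 0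

/-- **`C U = y ↔ (42)`**: the datum of `U` is the datum of the data `(V_j)` iff `U` satisfies «Ū^j = V_j on Λ_j, j ≤ k».
[cite: Balaban1985UV3, (42) p.266; Balaban1985Variational, (3) p.278] -/
theorem datum_eq_ofData_iff {k : ℕ} {Λ : ℕ → Set (Site P 0)} {V : (j : ℕ) → GaugeField P j (Matrix.unitaryGroup (Fin N) ℂ)}
    {U : GaugeField P 0 (Matrix.unitaryGroup (Fin N) ℂ)} :
    datum k Λ U = ofData k Λ V ↔ Constraint42 k Λ V U := by
  classical
  constructor
  · intro h j hj b hb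
    have h' := congr_fun (congr_fun h j) b
    simp only [datum, ofData, hj, hb, and_self, if_true] at h'
    exact h'
  · intro h
    funext j b
    simp only [datum, ofData]
    split_ifs with hc
    · exact h j hc.1 b hc.2
    · rfl

/-- **[7]'s `𝔅_k(𝔅_k, V)` ON THE TORUS**: the level-k fibre of the cell's dictionary over the datum of `(V_j)` is the (42)-constraint
set. [cite: Balaban1985Variational, (3) p.278; Balaban1985UV3, (42) p.266] -/
theorem fibK_datum (k : ℕ) (Λ : ℕ → Set (Site P 0)) (V : (j : ℕ) → GaugeField P j (Matrix.unitaryGroup (Fin N) ℂ)) :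
    fibK (datum k Λ) (ofData k Λ V) = {U | Constraint42 k Λ V U} := by
  ext U
  rw [mem_fibK]
  exact datum_eq_ofData_iff

/-- **`LevelMin` ⇒ (42)**: if the cell's level-k minimality package holds for the CONCRETE datum map — `LevelMin A (datum k Λ) R T U_k`:
for every admissible datum `y ∈ T`, `U_k(y) ∈ R y`, `C (U_k y) = y`, and `A (U_k y) ≤ A x` for all `x ∈ R y` with `C x = y` — then for
every data family `(V_j)` whose datum is admissible, `U_k = U_k(ofData V)` IS A MINIMUM (42) in the region `R y`.
[cite: Balaban1985UV3, (42) p.266; Balaban1985Variational, Thm 1 (8) p.279] -/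
theorem isMin42_of_levelMin {A : GaugeField P 0 (Matrix.unitaryGroup (Fin N) ℂ) → ℝ}
    {R : KData P N → Set (GaugeField P 0 (Matrix.unitaryGroup (Fin N) ℂ))} {T : Set (KData P N)}
    {Uk : KData P N → GaugeField P 0 (Matrix.unitaryGroup (Fin N) ℂ)} {k : ℕ} {Λ : ℕ → Set (Site P 0)}
    (h : LevelMin A (datum k Λ) R T Uk) {V : (j : ℕ) → GaugeField P j (Matrix.unitaryGroup (Fin N) ℂ)}
    (hV : ofData k Λ V ∈ T) :
    IsMin42 A (R (ofData k Λ V)) k Λ V (Uk (ofData k Λ V)) :=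
  ⟨h.mem _ hV, datum_eq_ofData_iff.mp (h.datum _ hV),
    fun U' hU' hC' => h.isMin _ hV U' hU' (datum_eq_ofData_iff.mpr hC')⟩

/-- **(42) ⇒ `LevelMin`**: conversely, if the admissible data are data of families `(V_j)` and for each of them `U_k(y)` is a
(42)-minimum in `R y`, the package `LevelMin A (datum k Λ) R T U_k` holds — so, on the torus carrier, (L1) of the cell's step IS the
sentence (42). [cite: Balaban1985UV3, (42) p.266; Balaban1985Variational, Thm 1 (8) p.279] -/
theorem levelMin_of_isMin42 {A : GaugeField P 0 (Matrix.unitaryGroup (Fin N) ℂ) → ℝ}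
    {R : KData P N → Set (GaugeField P 0 (Matrix.unitaryGroup (Fin N) ℂ))} {T : Set (KData P N)}
    {Uk : KData P N → GaugeField P 0 (Matrix.unitaryGroup (Fin N) ℂ)} {k : ℕ} {Λ : ℕ → Set (Site P 0)}
    (hT : ∀ y ∈ T, ∃ V : (j : ℕ) → GaugeField P j (Matrix.unitaryGroup (Fin N) ℂ), y = ofData k Λ V)
    (hmin : ∀ V : (j : ℕ) → GaugeField P j (Matrix.unitaryGroup (Fin N) ℂ), ofData k Λ V ∈ T →
      IsMin42 A (R (ofData k Λ V)) k Λ V (Uk (ofData k Λ V))) :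
    LevelMin A (datum k Λ) R T Uk := by
  refine ⟨fun y hy => ?_, fun y hy => ?_, fun y hy x hx hxy => ?_⟩
  · obtain ⟨V, rfl⟩ := hT y hy
    exact (hmin V hy).1
  · obtain ⟨V, rfl⟩ := hT y hy
    exact datum_eq_ofData_iff.mpr (hmin V hy).2.1
  · obtain ⟨V, rfl⟩ := hT y hy
    exact (hmin V hy).2.2 x hx (datum_eq_ofData_iff.mp hxy)

variable [NeZero N]

/-- **(67) FOR `U_k = U_k(y)` OF A `LevelMin` PACKAGE** (the gen-57 target «(67) identification from `LevelMin` for print's averaging»):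
for an admissible datum of a family `(V_j)` and `p′ ⊂ Λ_j`, `j ≤ k`, `Ū_k^j(∂p′) = V_j(∂p′)`. [cite: Balaban1985UV3, (67) p.273, (42) p.266] -/
theorem eq67_of_levelMin {A : GaugeField P 0 (Matrix.unitaryGroup (Fin N) ℂ) → ℝ}
    {R : KData P N → Set (GaugeField P 0 (Matrix.unitaryGroup (Fin N) ℂ))} {T : Set (KData P N)}
    {Uk : KData P N → GaugeField P 0 (Matrix.unitaryGroup (Fin N) ℂ)} {k : ℕ} {Λ : ℕ → Set (Site P 0)}
    (h : LevelMin A (datum k Λ) R T Uk) {V : (j : ℕ) → GaugeField P j (Matrix.unitaryGroup (Fin N) ℂ)}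
    (hV : ofData k Λ V ∈ T) {j : ℕ} (hj : j ≤ k) {p' : Plaq P j} (hp' : p' ∈ plaqsIn j (Λ j)) :
    ((holT (avgT j (Uk (ofData k Λ V))) p'.src (plaqWord p'.μ p'.ν) : (Matrix (Fin N) (Fin N) ℂ)ˣ) :
        Matrix (Fin N) (Fin N) ℂ) =
      ((GaugeField.plaqHol (V j) p' : Matrix.unitaryGroup (Fin N) ℂ) : Matrix (Fin N) (Fin N) ℂ) :=
  (isMin42_of_levelMin h hV).eq67 hj hp'

end LevelMinDict

/-! ## §6 The knit: Sect. D's small factors for all large-field plaquettes from (42), the large-field condition and (68) -/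

section Knit

open scoped Matrix.Norms.L2Operator

variable (M₁ : ℕ) (R : ℕ → ℝ) (Ω₀ : Set (Site P 0)) (S : (j : ℕ) → Finset (Plaq P j))
variable {N : ℕ} [NeZero N]

/-- Print's regions below the top level ARE the cell's `B10LargeField.Λ` («Λ_j = Ω_j^{(j)}∖Ω_{j+1}^{(j)}») of the generated torus
sequence of record `B10Eq38TorusDomains.ruleSeq` (gen 52) at the large-field corner sets — the two vocabularies agree by `rfl`.
[cite: Balaban1985UV3, (40)–(42) p.266, (38) p.266] -/
theorem lam42_eq_Λ_ruleSeq {k j : ℕ} (hjk : j < k) :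
    lam42 (B10Eq71TorusOverlap.Ω M₁ R Ω₀ S) k j =
      B10LargeField.Λ (B10Eq38TorusDomains.ruleSeq P M₁ R Ω₀ (fun i => cornerPts i (S i))) j := by
  rw [lam42_of_lt hjk]
  rfl

/-- **«Let us take a plaquette p′ ⊂ Λ_j»** (p. 273) IS WHERE THE LARGE-FIELD PLAQUETTES ARE: for the domains generated by the p. 268
rule from the large-field plaquette sets `P_i = S i` (`B10Eq71TorusOverlap.Ω`), a large-field plaquette `p′ ∈ P_j` of the passage
`j → j+1` made on the domain (`S j ⊆ plaqsIn j Ω_j`, p. 267 «(7) for the field V on the domain Λ_k») has all four corners in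
`Λ_j = Ω_j∖Ω_{j+1}` for `j < k` (its corners are points of `P_j ⊆ Z_j = Ω_{j+1}ᶜ`, `B10Eq38TorusDomains.largeField_subset_Z_ruleSeq`,
p. 257 «in fact dist(P, Ω₁) > RM₁») and in `Λ_k = Ω_k` at the top level. [cite: Balaban1985UV3, p.273, (40)–(42) p.266, p.268, p.257] -/
theorem mem_plaqsIn_lam42 (hR : ∀ i, 0 ≤ R i * M₁) {k j : ℕ} (hjk : j ≤ k)
    (hS : S j ⊆ plaqsIn j (B10Eq71TorusOverlap.Ω M₁ R Ω₀ S j)) {p : Plaq P j} (hp : p ∈ S j) :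
    p ∈ plaqsIn j (lam42 (B10Eq71TorusOverlap.Ω M₁ R Ω₀ S) k j) := by
  rcases Nat.lt_or_ge j k with hlt | hge
  · rw [lam42_of_lt hlt, mem_plaqsIn_iff]
    intro x hx
    refine ⟨(mem_plaqsIn_iff.mp (hS hp)) hx, ?_⟩
    have hZ := largeField_subset_Z_ruleSeq hR Ω₀ (fun i => cornerPts i (S i)) j (cornerSet_subset_cornerPts hp hx)
    exact hZ
  · have hjk' : j = k := le_antisymm hjk hge
    subst hjk'
    rw [lam42_self]
    exact hS hp

/-- **THE SMALL FACTORS OF ALL LARGE-FIELD PLAQUETTES AGAINST THE FULL ACTION, FROM (42)** (`G = U(N)`, `d = 3`): in the setting of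
`B10Eq69TorusPullback.quarter_sum_le_wilsonAction_concrete` (domains generated by the p. 268 rule from the large-field sets `S`,
`R(g_i)M₁ ≥ 0`, `L ∣ M₁`, levels `j ∈ J`, `j ≤ m + K`, `j ≤ k`, the history's plaquettes `S′ j ⊆ S j ⊆ plaqsIn j Ω_j`), IF `U = U_k`
SATISFIES THE CONSTRAINT (42) «Ū^j = V_j on Λ_j, j ≤ k» for print's regions `lam42 Ω k` and the data `(V_j)`, then with the
large-field condition «|V_j(∂p′) − 1| ≥ g_jp(g_j)», (68) on `Δ′_j(p′)` (all orientations, `O(1) = C₁`), `g_k² = g_j²L^{k−j}` and «g_j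
sufficiently small» (as in gen 57): **`¼·Σ_{j∈J} Σ_{p′∈S′ j} ¼p_j² ≤ (N/g_k²)·A^η(U_k)`** — the hypothesis (67) of gen 57 is now the
THEOREM `eq67_of_constraint42` at the plaquettes `p′ ⊂ Λ_j` of `mem_plaqsIn_lam42`. [cite: Balaban1985UV3, (67)–(71) p.273, (42) p.266, (41) p.266, (5) p.256] -/
theorem quarter_sum_le_wilsonAction_of_constraint42 (hd : P.d = 3) (hR : ∀ i, 0 ≤ R i * M₁) (hdiv : P.L ∣ M₁)
    (J : Finset ℕ) (hJ : ∀ j ∈ J, j ≤ P.m + P.K) {k : ℕ} (hJk : ∀ j ∈ J, j ≤ k) (S' : (j : ℕ) → Finset (Plaq P j))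
    (hS' : ∀ j ∈ J, S' j ⊆ S j)
    (hS : ∀ j ∈ J, S j ⊆ plaqsIn j (B10Eq71TorusOverlap.Ω M₁ R Ω₀ S j))
    (U : GaugeField P 0 (Matrix.unitaryGroup (Fin N) ℂ)) (V : (j : ℕ) → GaugeField P j (Matrix.unitaryGroup (Fin N) ℂ))
    (h42 : Constraint42 k (lam42 (B10Eq71TorusOverlap.Ω M₁ R Ω₀ S) k) V U)
    (g : ℕ → ℝ) (pj : ℕ → ℝ) {gk C₁ : ℝ} (hC₁ : 0 < C₁)
    (hgj : ∀ j ∈ J, 0 < g j) (hgk : ∀ j ∈ J, gk ^ 2 = g j ^ 2 * (P.L : ℝ) ^ (k - j)) (hp : ∀ j ∈ J, 0 < pj j)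
    (hgp : ∀ j ∈ J, g j * pj j ≤ 1)
    (hLF : ∀ j ∈ J, ∀ p' ∈ S' j, g j * pj j ≤ dist1 (GaugeField.plaqHol (V j) p'))
    (h68 : ∀ j ∈ J, ∀ p' ∈ S' j, ∀ q ∈ deltaAllT j p',
      dist1 (GaugeField.plaqHol U q) ≤ C₁ * (g j * pj j) / ((P.L : ℝ) ^ j) ^ 2)
    (hα3 : ∀ j ∈ J, C0 3 * (2 * C₁ * (g j * pj j)) ≤ 1 / 3) (hα2 : ∀ j ∈ J, 2 * (2 * C₁ * (g j * pj j)) ≤ c2' 3 P.L)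
    (hsmall : ∀ j ∈ J, (2 * C₁ * (64 / 3 * C0 3 * C₁ ^ 2) + (64 / 3 * C0 3 * C₁ ^ 2) ^ 2) / 2 * g j * pj j ≤ 1 / 4) :
    (1 / 4 : ℝ) * ∑ j ∈ J, ∑ _p' ∈ S' j, pj j ^ 2 / 4 ≤
      ((gk ^ 2)⁻¹ * (N : ℝ)) * actionEta k U := by
  have hS'Λ : ∀ j ∈ J, S' j ⊆ plaqsIn j (lam42 (B10Eq71TorusOverlap.Ω M₁ R Ω₀ S) k j) :=
    fun j hj p hp => mem_plaqsIn_lam42 M₁ R Ω₀ S hR (hJk j hj) (hS j hj) (hS' j hj hp)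
  rw [actionEta_eq]
  exact quarter_sum_le_wilsonAction_concrete M₁ R Ω₀ S hd hR hdiv J hJ hJk S' hS' hS U V g pj hC₁ hgj hgk hp hgp
    (h67_of_constraint42 h42 J hJk S' hS'Λ) hLF h68 hα3 hα2 hsmall

/-- The same for the semi-simple group `G = SU(N)` of Theorem 1: the constraint (42) for the `U(N)`-read configuration
`toUField U` and data `toUField ∘ V`. [cite: Balaban1985UV3, (67)–(71) p.273, (42) p.266, Thm 1 p.257] -/
theorem quarter_sum_le_wilsonAction_of_constraint42_specialUnitaryGroup (hd : P.d = 3) (hR : ∀ i, 0 ≤ R i * M₁)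
    (hdiv : P.L ∣ M₁) (J : Finset ℕ) (hJ : ∀ j ∈ J, j ≤ P.m + P.K) {k : ℕ} (hJk : ∀ j ∈ J, j ≤ k)
    (S' : (j : ℕ) → Finset (Plaq P j)) (hS' : ∀ j ∈ J, S' j ⊆ S j)
    (hS : ∀ j ∈ J, S j ⊆ plaqsIn j (B10Eq71TorusOverlap.Ω M₁ R Ω₀ S j))
    (U : GaugeField P 0 (Matrix.specialUnitaryGroup (Fin N) ℂ))
    (V : (j : ℕ) → GaugeField P j (Matrix.specialUnitaryGroup (Fin N) ℂ))
    (h42 : Constraint42 k (lam42 (B10Eq71TorusOverlap.Ω M₁ R Ω₀ S) k) (fun j => toUField (V j)) (toUField U))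
    (g : ℕ → ℝ) (pj : ℕ → ℝ) {gk C₁ : ℝ} (hC₁ : 0 < C₁)
    (hgj : ∀ j ∈ J, 0 < g j) (hgk : ∀ j ∈ J, gk ^ 2 = g j ^ 2 * (P.L : ℝ) ^ (k - j)) (hp : ∀ j ∈ J, 0 < pj j)
    (hgp : ∀ j ∈ J, g j * pj j ≤ 1)
    (hLF : ∀ j ∈ J, ∀ p' ∈ S' j, g j * pj j ≤ dist1 (GaugeField.plaqHol (V j) p'))
    (h68 : ∀ j ∈ J, ∀ p' ∈ S' j, ∀ q ∈ deltaAllT j p',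
      dist1 (GaugeField.plaqHol U q) ≤ C₁ * (g j * pj j) / ((P.L : ℝ) ^ j) ^ 2)
    (hα3 : ∀ j ∈ J, C0 3 * (2 * C₁ * (g j * pj j)) ≤ 1 / 3) (hα2 : ∀ j ∈ J, 2 * (2 * C₁ * (g j * pj j)) ≤ c2' 3 P.L)
    (hsmall : ∀ j ∈ J, (2 * C₁ * (64 / 3 * C0 3 * C₁ ^ 2) + (64 / 3 * C0 3 * C₁ ^ 2) ^ 2) / 2 * g j * pj j ≤ 1 / 4) :
    (1 / 4 : ℝ) * ∑ j ∈ J, ∑ _p' ∈ S' j, pj j ^ 2 / 4 ≤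
      ((gk ^ 2)⁻¹ * (N : ℝ)) * wilsonAction ((P.L : ℝ) ^ k) U := by
  have hS'Λ : ∀ j ∈ J, S' j ⊆ plaqsIn j (lam42 (B10Eq71TorusOverlap.Ω M₁ R Ω₀ S) k j) :=
    fun j hj p hp => mem_plaqsIn_lam42 M₁ R Ω₀ S hR (hJk j hj) (hS j hj) (hS' j hj hp)
  have h67 := h67_of_constraint42 h42 J hJk S' hS'Λ
  refine quarter_sum_le_wilsonAction_concrete_specialUnitaryGroup M₁ R Ω₀ S hd hR hdiv J hJ hJk S' hS' hS U V g pj hC₁ hgj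
    hgk hp hgp (fun j hj p' hp' => ?_) hLF h68 hα3 hα2 hsmall
  rw [h67 j hj p' hp', B10Eq27TorusAxialLog.plaqHol_toUField]
  rfl

/-- **THE SAME FROM A `LevelMin` PACKAGE** (the cell's reading of [7] Theorem 1 at level `k`): with `U_k = U_k(y)` for the admissible
datum `y = ofData k Λ V` of the family `(V_j)`, `Λ = lam42 Ω k`, the small factors of all large-field plaquettes hold against
`(N/g_k²)A^η(U_k)` under the large-field condition, (68) and the coupling smallness only. [cite: Balaban1985UV3, (67)–(71) p.273, (42) p.266; Balaban1985Variational, Thm 1 (8) p.279] -/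
theorem quarter_sum_le_wilsonAction_of_levelMin (hd : P.d = 3) (hR : ∀ i, 0 ≤ R i * M₁) (hdiv : P.L ∣ M₁)
    (J : Finset ℕ) (hJ : ∀ j ∈ J, j ≤ P.m + P.K) {k : ℕ} (hJk : ∀ j ∈ J, j ≤ k) (S' : (j : ℕ) → Finset (Plaq P j))
    (hS' : ∀ j ∈ J, S' j ⊆ S j)
    (hS : ∀ j ∈ J, S j ⊆ plaqsIn j (B10Eq71TorusOverlap.Ω M₁ R Ω₀ S j))
    {A : GaugeField P 0 (Matrix.unitaryGroup (Fin N) ℂ) → ℝ}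
    {Rg : KData P N → Set (GaugeField P 0 (Matrix.unitaryGroup (Fin N) ℂ))} {T : Set (KData P N)}
    {Uk : KData P N → GaugeField P 0 (Matrix.unitaryGroup (Fin N) ℂ)}
    (hL : LevelMin A (datum k (lam42 (B10Eq71TorusOverlap.Ω M₁ R Ω₀ S) k)) Rg T Uk)
    (V : (j : ℕ) → GaugeField P j (Matrix.unitaryGroup (Fin N) ℂ))
    (hV : ofData k (lam42 (B10Eq71TorusOverlap.Ω M₁ R Ω₀ S) k) V ∈ T)
    (g : ℕ → ℝ) (pj : ℕ → ℝ) {gk C₁ : ℝ} (hC₁ : 0 < C₁)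
    (hgj : ∀ j ∈ J, 0 < g j) (hgk : ∀ j ∈ J, gk ^ 2 = g j ^ 2 * (P.L : ℝ) ^ (k - j)) (hp : ∀ j ∈ J, 0 < pj j)
    (hgp : ∀ j ∈ J, g j * pj j ≤ 1)
    (hLF : ∀ j ∈ J, ∀ p' ∈ S' j, g j * pj j ≤ dist1 (GaugeField.plaqHol (V j) p'))
    (h68 : ∀ j ∈ J, ∀ p' ∈ S' j, ∀ q ∈ deltaAllT j p',
      dist1 (GaugeField.plaqHol (Uk (ofData k (lam42 (B10Eq71TorusOverlap.Ω M₁ R Ω₀ S) k) V)) q) ≤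
        C₁ * (g j * pj j) / ((P.L : ℝ) ^ j) ^ 2)
    (hα3 : ∀ j ∈ J, C0 3 * (2 * C₁ * (g j * pj j)) ≤ 1 / 3) (hα2 : ∀ j ∈ J, 2 * (2 * C₁ * (g j * pj j)) ≤ c2' 3 P.L)
    (hsmall : ∀ j ∈ J, (2 * C₁ * (64 / 3 * C0 3 * C₁ ^ 2) + (64 / 3 * C0 3 * C₁ ^ 2) ^ 2) / 2 * g j * pj j ≤ 1 / 4) :
    (1 / 4 : ℝ) * ∑ j ∈ J, ∑ _p' ∈ S' j, pj j ^ 2 / 4 ≤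
      ((gk ^ 2)⁻¹ * (N : ℝ)) * actionEta k (Uk (ofData k (lam42 (B10Eq71TorusOverlap.Ω M₁ R Ω₀ S) k) V)) :=
  quarter_sum_le_wilsonAction_of_constraint42 M₁ R Ω₀ S hd hR hdiv J hJ hJk S' hS' hS _ V
    (isMin42_of_levelMin hL hV).constraint g pj hC₁ hgj hgk hp hgp hLF h68 hα3 hα2 hsmall

end Knit

end Literature.MathematicalPhysics.QuantumFieldTheory.Balaban1983to89.B10Eq42TorusConstraint
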